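import Mathlib
import HarnessLib
import Summits.CriticalPhenomena.CardyFormulaZ2.Theses.CardySelfDualSegment
import Literature.Probability.Percolation.CornerPercolation
import Literature.Probability.RandomPlanarGeometry.ShearModulusAnalytic
import Summits.CriticalPhenomena.CardyFormulaZ2.Theorems.CardySelfDualSegmentSegmentOpenReduction
import Summits.CriticalPhenomena.CardyFormulaZ2.Theorems.CardySelfDualSegmentSegmentOpenStubShearCrossRatioAnalytic
import Summits.CriticalPhenomena.CardyFormulaZ2.Theorems.CardySelfDualSegmentSmirnovBasePoint
import Summits.CriticalPhenomena.CardyFormulaZ2.Theorems.CardySelfDualSegmentSegmentOpenUAImpliesUM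

/-!
# Crux `SegmentOpen` (stmt-CriticalPhenomena-5471), line `Sketch` — the ROUTE-LEVEL (Smirnov-germ) form

Kernel-checked record (lead c3) of card B's composition C⁺₂ (`Ideas/vitali-transfer-smirnov-germ.md`,
§Transfer), which no skeleton used so far.  Inside the ROUTE the crux `SegmentOpen` is consumed by
the deciding theorem `closes` together with the sibling cruxes `SegmentClosed` (stmt-5473) and
`UniformBoxCrossing` (stmt-5476).  Taking those two ROUTE DECLS as hypotheses (conditional result —
nothing is claimed about them), line `Sketch`'s research stub S6 ("no good point is isolated",
perturbative linear universality at EVERY Cardy point `t₀ ∈ G`) weakens to its `t₀ = 0` instance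

  S6₀ (SMIRNOV GERM):  `AccPt 0 (𝓟 G)` — the Smirnov point is not isolated in the good set,

i.e. perturbative linear universality at the ONE solved point of the segment (site-𝕋, where the
scaling limit, the arm exponents and a discrete stress tensor exist).  Precisely, with S4 =
`stub_uniformComplexBound` (hypothesis, verbatim; it also yields `UniformMarginality`, p131349):

* `SmirnovGerm.goodSet_eq_univ`: S4 → `IsClosed G` → `AccPt 0 (𝓟 G)` → `G = univ`
  (0 ∈ G by `smirnovBasePoint_proof`; accumulation ⇒ interior at good points by the landed S5'
  `stub_accumulationInteriorGood` fed with S7 `stub_shearCrossRatioAnalytic`, S2'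
  `stub_vitaliTransferUniform` and S1 + S4; then the clopen sweep of the interior);
* `segmentOpen_of_segmentClosed_of_smirnovGerm`:
  S4 → `SegmentClosed` → `UniformBoxCrossing` → `AccPt 0 (𝓟 G)` → `SegmentOpen`;
* `target_of_segmentClosed_of_smirnovGerm`: the same hypotheses give the route's `Target` directly,
  and `target_iff_smirnovGerm`: under S4, `SegmentClosed`, `UniformBoxCrossing` the Target is
  EQUIVALENT to the Smirnov germ S6₀.

Reading for the planners: for the ROUTE (not for the crux as filed) the research residue of line
`Sketch` is {S4 (uniform analyticity, ⊢ UM), S6₀ (Smirnov germ)} plus the sibling cruxes 5473, 5476.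
-/

noncomputable section

namespace Summit.CriticalPhenomena.CardyFormulaZ2.Theorems

open Literature.Probability Literature.Barriers.CriticalPhenomena
open Literature.Probability.RandomPlanarGeometry (ConformalRectangle ConformalEquiv MarkedDomain)
open Filter Set Topology

namespace SmirnovGerm

/-- A closed subset of `[0,1]` whose accumulation points are interior points and which accumulates
at `0` is all of `[0,1]`: its interior is clopen and contains `0`, and `unitInterval` is
connected. -/
theorem eq_univ_of_isClosed_of_accPt {G : Set unitInterval} (hc : IsClosed G)
    (hacc : ∀ t ∈ G, AccPt t (𝓟 G) → t ∈ interior G) (h0 : AccPt (0 : unitInterval) (𝓟 G)) :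
    G = univ := by
  -- adapted from Cruxes/SegmentOpen/SketchIdeator1.lean (crux-ideate r1, ideator 1)
  classical
  -- a closed set contains its accumulation points
  have hmemG : ∀ t, AccPt t (𝓟 G) → t ∈ G := fun t ht => by
    have hfr := accPt_iff_frequently.1 ht
    have : t ∈ closure G := mem_closure_iff_frequently.2 (hfr.mono fun _ h => h.2)
    simpa [hc.closure_eq] using this
  set I : Set unitInterval := interior G with hI
  have hIopen : IsOpen I := isOpen_interior
  -- `I` is closed: boundary points of `I` are accumulation points of `G`, hence interior points
  have hIclosed : IsClosed I := by
    rw [← closure_subset_iff_isClosed]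
    intro b hb
    by_cases hbI : b ∈ I
    · exact hbI
    · have hfrI : ∃ᶠ y in 𝓝 b, y ∈ I := mem_closure_iff_frequently.1 hb
      have haccI : AccPt b (𝓟 I) := by
        rw [accPt_iff_frequently]
        exact hfrI.mono fun y hy => ⟨fun h => hbI (h ▸ hy), hy⟩
      have haccG : AccPt b (𝓟 G) := haccI.mono (principal_mono.2 interior_subset)
      exact hacc b (hmemG b haccG) haccG
  have h0I : (0 : unitInterval) ∈ I := hacc 0 (hmemG 0 h0) h0
  haveI : PreconnectedSpace unitInterval := Subtype.preconnectedSpace isPreconnected_Icc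
  have hIuniv : I = univ := IsClopen.eq_univ ⟨hIclosed, hIopen⟩ ⟨0, h0I⟩
  exact eq_univ_of_univ_subset (hIuniv ▸ interior_subset)

/-- **S4 + closedness + Smirnov germ ⇒ `G = [0,1]`.**  Under S4 (hypothesis `h4`, verbatim
`stub_uniformComplexBound`; NOT claimed) every good ACCUMULATION point of the good set `G` is an
interior point (landed S5' `stub_accumulationInteriorGood`, fed by the landed S7
`stub_shearCrossRatioAnalytic`, S2' `stub_vitaliTransferUniform` and S1 + S4); so if `G` is closed
and accumulates at `0`, the clopen sweep `eq_univ_of_isClosed_of_accPt` gives `G = univ`. -/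
theorem goodSet_eq_univ
    (h4 : ∀ t₀ : unitInterval, ∃ r > 0, ∀ R : ConformalRectangle, ∃ C : ℝ, ∀ δ : ℝ, 0 < δ →
      ∀ p : Polynomial ℝ,
        (∀ t : unitInterval, Percolation.cornerCrossingProb t R δ = p.eval (t : ℝ)) →
        ∀ z ∈ Metric.ball ((t₀ : ℝ) : ℂ) r, ‖(p.map (algebraMap ℝ ℂ)).eval z‖ ≤ C)
    (hcl : IsClosed {t : unitInterval | ∃ α : ℂ, 0 < α.im ∧
        ∀ (R R' : ConformalRectangle)
          (φ : ConformalEquiv UpperHalfPlane.upperHalfPlaneSet R.carrier) (x : Fin 4 → ℝ),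
          R.carrier = moduliShear α '' R'.carrier → (∀ i, R.pt i = moduliShear α (R'.pt i)) →
          R.IsUniformizing φ x →
          Tendsto (Percolation.cornerCrossingProb t R') (𝓝[>] 0)
            (𝓝 (RandomPlanarGeometry.cardyFunction (RandomPlanarGeometry.crossRatio x)))})
    (h0 : AccPt (0 : unitInterval) (𝓟 {t : unitInterval | ∃ α : ℂ, 0 < α.im ∧
        ∀ (R R' : ConformalRectangle)
          (φ : ConformalEquiv UpperHalfPlane.upperHalfPlaneSet R.carrier) (x : Fin 4 → ℝ),
          R.carrier = moduliShear α '' R'.carrier → (∀ i, R.pt i = moduliShear α (R'.pt i)) →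
          R.IsUniformizing φ x →
          Tendsto (Percolation.cornerCrossingProb t R') (𝓝[>] 0)
            (𝓝 (RandomPlanarGeometry.cardyFunction (RandomPlanarGeometry.crossRatio x)))})) :
    {t : unitInterval | ∃ α : ℂ, 0 < α.im ∧
        ∀ (R R' : ConformalRectangle)
          (φ : ConformalEquiv UpperHalfPlane.upperHalfPlaneSet R.carrier) (x : Fin 4 → ℝ),
          R.carrier = moduliShear α '' R'.carrier → (∀ i, R.pt i = moduliShear α (R'.pt i)) →
          R.IsUniformizing φ x →
          Tendsto (Percolation.cornerCrossingProb t R') (𝓝[>] 0)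
            (𝓝 (RandomPlanarGeometry.cardyFunction (RandomPlanarGeometry.crossRatio x)))} = univ :=
  eq_univ_of_isClosed_of_accPt hcl
    (fun t ht hacc => stub_accumulationInteriorGood stub_shearCrossRatioAnalytic
      (fun t₀ R r => stub_vitaliTransferUniform t₀ R r) t
      (SegmentOpenSketch.uaNear_of_uniformComplexBound t (h4 t)) ht hacc) h0

end SmirnovGerm

/-- The sibling crux `SegmentClosed` (stmt-5473) unfolds (zeta) to
`UniformBoxCrossing → UniformMarginality → IsClosed G` over the library vocabulary. -/
theorem segmentClosed_iff :
    Summit.CriticalPhenomena.CardyFormulaZ2.Theses.CardySelfDualSegment.SegmentClosed ↔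
      (Summit.CriticalPhenomena.CardyFormulaZ2.Theses.CardySelfDualSegment.UniformBoxCrossing →
        Summit.CriticalPhenomena.CardyFormulaZ2.Theses.CardySelfDualSegment.UniformMarginality →
        IsClosed {t : unitInterval | ∃ α : ℂ, 0 < α.im ∧
          ∀ (R R' : ConformalRectangle)
            (φ : ConformalEquiv UpperHalfPlane.upperHalfPlaneSet R.carrier) (x : Fin 4 → ℝ),
            R.carrier = moduliShear α '' R'.carrier → (∀ i, R.pt i = moduliShear α (R'.pt i)) →
            R.IsUniformizing φ x →
            Tendsto (Percolation.cornerCrossingProb t R') (𝓝[>] 0)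
              (𝓝 (RandomPlanarGeometry.cardyFunction (RandomPlanarGeometry.crossRatio x)))}) :=
  Iff.rfl

/-- The route's `Target` unfolds (zeta) to `G = [0,1]` read pointwise over the library vocabulary. -/
theorem target_iff_forall_mem_goodSet :
    Summit.CriticalPhenomena.CardyFormulaZ2.Theses.CardySelfDualSegment.Target ↔
      ∀ t : unitInterval, t ∈ {t : unitInterval | ∃ α : ℂ, 0 < α.im ∧
          ∀ (R R' : ConformalRectangle)
            (φ : ConformalEquiv UpperHalfPlane.upperHalfPlaneSet R.carrier) (x : Fin 4 → ℝ),
            R.carrier = moduliShear α '' R'.carrier → (∀ i, R.pt i = moduliShear α (R'.pt i)) →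
            R.IsUniformizing φ x →
            Tendsto (Percolation.cornerCrossingProb t R') (𝓝[>] 0)
              (𝓝 (RandomPlanarGeometry.cardyFunction (RandomPlanarGeometry.crossRatio x)))} :=
  Iff.rfl

/-- **Route-level form of the crux: `SegmentOpen` from S4, the sibling cruxes and the SMIRNOV GERM
only.**  Assume S4 (verbatim `stub_uniformComplexBound`), the ROUTE DECLS `SegmentClosed`
(stmt-5473) and `UniformBoxCrossing` (stmt-5476) — all hypotheses, none claimed — and the Smirnov
germ S6₀: `0` is an accumulation point of the good set `G`.  Then `SegmentOpen` holds: S4 gives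
`UniformMarginality` (`uniformMarginality_of_uniformComplexBound`, p131349), hence `G` is closed
(`SegmentClosed` fed by `UniformBoxCrossing`), hence `G = univ` (`SmirnovGerm.goodSet_eq_univ`),
which is open.  Compared with the line's S6 (non-isolation at EVERY good point, under UM) only the
point `t₀ = 0` is examined. -/
theorem segmentOpen_of_segmentClosed_of_smirnovGerm :
    (∀ t₀ : unitInterval, ∃ r > 0, ∀ R : ConformalRectangle, ∃ C : ℝ, ∀ δ : ℝ, 0 < δ →
      ∀ p : Polynomial ℝ,
        (∀ t : unitInterval, Percolation.cornerCrossingProb t R δ = p.eval (t : ℝ)) →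
        ∀ z ∈ Metric.ball ((t₀ : ℝ) : ℂ) r, ‖(p.map (algebraMap ℝ ℂ)).eval z‖ ≤ C) →
    Summit.CriticalPhenomena.CardyFormulaZ2.Theses.CardySelfDualSegment.SegmentClosed →
    Summit.CriticalPhenomena.CardyFormulaZ2.Theses.CardySelfDualSegment.UniformBoxCrossing →
    AccPt (0 : unitInterval) (𝓟 {t : unitInterval | ∃ α : ℂ, 0 < α.im ∧
        ∀ (R R' : ConformalRectangle)
          (φ : ConformalEquiv UpperHalfPlane.upperHalfPlaneSet R.carrier) (x : Fin 4 → ℝ),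
          R.carrier = moduliShear α '' R'.carrier → (∀ i, R.pt i = moduliShear α (R'.pt i)) →
          R.IsUniformizing φ x →
          Tendsto (Percolation.cornerCrossingProb t R') (𝓝[>] 0)
            (𝓝 (RandomPlanarGeometry.cardyFunction (RandomPlanarGeometry.crossRatio x)))}) →
    Summit.CriticalPhenomena.CardyFormulaZ2.Theses.CardySelfDualSegment.SegmentOpen := by
  intro h4 hC hX h0 _
  have hM := uniformMarginality_of_uniformComplexBound h4
  have hcl := (segmentClosed_iff.1 hC) hX hM
  have huniv := SmirnovGerm.goodSet_eq_univ h4 hcl h0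
  -- `G = univ` is open
  exact huniv ▸ isOpen_univ

/-- **The route's `Target` from S4, the sibling cruxes and the Smirnov germ.**  Same hypotheses as
`segmentOpen_of_segmentClosed_of_smirnovGerm` (S4 verbatim `stub_uniformComplexBound`, route decls
`SegmentClosed` and `UniformBoxCrossing`, all hypotheses; Smirnov germ `AccPt 0 (𝓟 G)`); conclusion
`Target` (= `G = [0,1]` pointwise).  0 ∈ G is the proved `smirnovBasePoint_proof`, used inside
`SmirnovGerm.goodSet_eq_univ` only through the accumulation hypothesis and closedness. -/
theorem target_of_segmentClosed_of_smirnovGerm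
    (h4 : ∀ t₀ : unitInterval, ∃ r > 0, ∀ R : ConformalRectangle, ∃ C : ℝ, ∀ δ : ℝ, 0 < δ →
      ∀ p : Polynomial ℝ,
        (∀ t : unitInterval, Percolation.cornerCrossingProb t R δ = p.eval (t : ℝ)) →
        ∀ z ∈ Metric.ball ((t₀ : ℝ) : ℂ) r, ‖(p.map (algebraMap ℝ ℂ)).eval z‖ ≤ C)
    (hC : Summit.CriticalPhenomena.CardyFormulaZ2.Theses.CardySelfDualSegment.SegmentClosed)
    (hX : Summit.CriticalPhenomena.CardyFormulaZ2.Theses.CardySelfDualSegment.UniformBoxCrossing)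
    (h0 : AccPt (0 : unitInterval) (𝓟 {t : unitInterval | ∃ α : ℂ, 0 < α.im ∧
        ∀ (R R' : ConformalRectangle)
          (φ : ConformalEquiv UpperHalfPlane.upperHalfPlaneSet R.carrier) (x : Fin 4 → ℝ),
          R.carrier = moduliShear α '' R'.carrier → (∀ i, R.pt i = moduliShear α (R'.pt i)) →
          R.IsUniformizing φ x →
          Tendsto (Percolation.cornerCrossingProb t R') (𝓝[>] 0)
            (𝓝 (RandomPlanarGeometry.cardyFunction (RandomPlanarGeometry.crossRatio x)))})) :
    Summit.CriticalPhenomena.CardyFormulaZ2.Theses.CardySelfDualSegment.Target := by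
  rw [target_iff_forall_mem_goodSet]
  have hM := uniformMarginality_of_uniformComplexBound h4
  have hcl := (segmentClosed_iff.1 hC) hX hM
  have huniv := SmirnovGerm.goodSet_eq_univ h4 hcl h0
  intro t
  rw [huniv]
  exact mem_univ t

/-- **Census statement (route level): under S4, `SegmentClosed` and `UniformBoxCrossing`, the
route's Target is EQUIVALENT to the Smirnov germ S6₀.**  `←` is
`target_of_segmentClosed_of_smirnovGerm`; `→`: if `G = [0,1]` then every point, in particular `0`,
is an accumulation point of `G` (the segment has no isolated points).  S4 and the two route decls
are hypotheses (not claimed). -/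
theorem target_iff_smirnovGerm
    (h4 : ∀ t₀ : unitInterval, ∃ r > 0, ∀ R : ConformalRectangle, ∃ C : ℝ, ∀ δ : ℝ, 0 < δ →
      ∀ p : Polynomial ℝ,
        (∀ t : unitInterval, Percolation.cornerCrossingProb t R δ = p.eval (t : ℝ)) →
        ∀ z ∈ Metric.ball ((t₀ : ℝ) : ℂ) r, ‖(p.map (algebraMap ℝ ℂ)).eval z‖ ≤ C)
    (hC : Summit.CriticalPhenomena.CardyFormulaZ2.Theses.CardySelfDualSegment.SegmentClosed)
    (hX : Summit.CriticalPhenomena.CardyFormulaZ2.Theses.CardySelfDualSegment.UniformBoxCrossing) :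
    Summit.CriticalPhenomena.CardyFormulaZ2.Theses.CardySelfDualSegment.Target ↔
      AccPt (0 : unitInterval) (𝓟 {t : unitInterval | ∃ α : ℂ, 0 < α.im ∧
        ∀ (R R' : ConformalRectangle)
          (φ : ConformalEquiv UpperHalfPlane.upperHalfPlaneSet R.carrier) (x : Fin 4 → ℝ),
          R.carrier = moduliShear α '' R'.carrier → (∀ i, R.pt i = moduliShear α (R'.pt i)) →
          R.IsUniformizing φ x →
          Tendsto (Percolation.cornerCrossingProb t R') (𝓝[>] 0)
            (𝓝 (RandomPlanarGeometry.cardyFunction (RandomPlanarGeometry.crossRatio x)))}) := by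
  constructor
  · intro hT
    rw [target_iff_forall_mem_goodSet] at hT
    have huniv : {t : unitInterval | ∃ α : ℂ, 0 < α.im ∧
        ∀ (R R' : ConformalRectangle)
          (φ : ConformalEquiv UpperHalfPlane.upperHalfPlaneSet R.carrier) (x : Fin 4 → ℝ),
          R.carrier = moduliShear α '' R'.carrier → (∀ i, R.pt i = moduliShear α (R'.pt i)) →
          R.IsUniformizing φ x →
          Tendsto (Percolation.cornerCrossingProb t R') (𝓝[>] 0)
            (𝓝 (RandomPlanarGeometry.cardyFunction (RandomPlanarGeometry.crossRatio x)))} =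
        univ := eq_univ_of_forall hT
    rw [huniv]
    exact accPt_principal_of_isOpen_unitInterval isOpen_univ (mem_univ _)
  · exact target_of_segmentClosed_of_smirnovGerm h4 hC hX

end Summit.CriticalPhenomena.CardyFormulaZ2.Theorems
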